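import Summits.QuantumFields.BalabanUV.T4Continuum.Support.GaugeTermSandwichLaw
import Summits.QuantumFields.BalabanUV.T4Continuum.Support.GaugeTermResolventBounds
import Summits.QuantumFields.BalabanUV.T4Continuum.Support.GaugeTermTwoLevelNumbers
import Summits.QuantumFields.BalabanUV.T4Continuum.Support.GaugeTermSandwichBound
import Summits.QuantumFields.BalabanUV.T4Continuum.Spine.NE2ColourPerturbedLayer

/-!
# T⁴ programme, spine node NE2 (U1a), tier B row B4.b — ONE LAYER OF THE GAUGE TERM ALONG THE TOWER: the typed objects
# `S_k = D_kᴴD_k + a′Q′_kᴴQ′_k`, `G′_k = S_k⁻¹`, `Z_k = Q′_kG′_kD_kᴴ`, `N_k = (Q′_kG′_k²Q′_kᴴ)⁻¹` on row B4.a's vocabulary, and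
# `SandwichLaws` for `(Z, N)` from a bundle of NUMBERS (`LayerLaws`)

ROUND-2 swarm `t4-ne2-formalise-*`, leaf prover 05, row **B4.b**, file 3a (files 1∕2a∕2b: `GaugeTermSandwichLaw` p207779,
`GaugeTermResolventBounds` p208240, `GaugeTermTwoLevelNumbers` p208302; row B4.a's objects: `GaugeTermDecomposition` p207876,
`GaugeTermSandwichBound` p208020, leaf-10).  For ONE family of data along the tower `n_k = L^k` — colour transporters
`R k : Fin d → Tor_k → M_o(ℂ)`, a scalar averaging `Q k : (unit layer γ) ← (Tor_k × o)`, a mass `a′ ≥ 0` and 0-form plantings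
`J₀ k : (Tor_{k+1} × o) ← (Tor_k × o)` — this file types, with `c_k = n_k`,
  `Sop k = scalOp (R k) a′ (Q k) = D_kᴴD_k + a′·Q_kᴴQ_k` ([Balaban1985BackgroundPropagators] (3.24) p.394, shape), `Gop k = (Sop k)⁻¹`,
  `Zt k = Zop (R k) (Gop k) (Q k) = Q_k·G′_k·D_kᴴ`, `Nt k = Nop (Gop k) (Q k) = (Q_kG′_kG′_kQ_kᴴ)⁻¹`,
  `gaugeP k = sand (R k) (projP (Gop k) (Q k)) = D_k·P_k·D_kᴴ` (the level-`k` gauge summand of ONE family, (3.25)/(3.26) shape),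
proves `gaugeP k = GaugeTermSandwichLaw.sandwich Zt Nt k` (**`gaugeP_eq_sandwich`**, from leaf-10's `sand_projP_eq`), and turns the bundle
**`LayerLaws R Q a′ J₀ g q α es ec θ q₁`** of NUMBERS — invertibility and `‖G′_k‖ ≤ g`, `‖Q_k‖ ≤ q`, `‖E_k‖ ≤ α` (the defect `D_k − ∂⊗1`,
row B5), the scalar injected / complement numbers `‖G′_{k+1}J₀ − J₀G′_k‖ ≤ es k`, `‖G′_{k+1}(1 − J₀J₀ᴴ)‖ ≤ ec k` (rows B4.d ∧ B4.e via
`BackgroundResolventLaw.perturbed_injected_law`), the sandwiched covariant-divergence planting number `θ k` (row B4.f) and the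
pairing `‖Q_{k+1}J₀ − Q_k‖ ≤ q₁ k` (row B3.a) — together with invertibility of `K_k = Q_kG′_kG′_kQ_kᴴ` and `‖N_k‖ ≤ nK` (row B4.c at
`U = 1`; `GaugeTermTwoLevelNumbers.unitFactor_bounds` at `U`) into
  **`sandwichLaws_of_layerLaws : SandwichLaws (k ↦ calDalev k ⊗ₖ 1) (k ↦ JpcT k ⊗ₖ 1) Zt Nt (q·√g) nK ζ ν`**
with `ζ k = q·θ k + q·es k·(d + α)·Cst + q₁ k·√g·Cst` and `ν k = nK²·(2qg·ε k + (ε k)² + q²g·ec k)`, `ε k = q·es k + q₁ k·g` — every step a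
named lemma of files 2a∕2b plus (1.89) in leaf-10's form `opNorm_gradH_mul_calG_le`.  File 3b (`GaugeTermPerturbationLaw`) takes two
families (`U` and `1`) to THE TARGET SHAPE by `perturbationLaws_sandwich_sub`.

HONEST FRAMING (T4-DAG p. 1).  Bookkeeping OURS over finite matrices; the only printed input is (1.89) via tree theorems; `R`, `Q`, `a′`,
`J₀` and all numbers are DATA ∕ hypotheses (model level; no assertion of the dictionary B0 that these are Bałaban's `U_k`, `Q′(U_k)`,
trigger c5); GLOBAL small field, finite torus, linear layer, operator norm; NOT [B9] (3.23)–(3.26) as printed; NE2 NOT proved; NOT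
infinite volume, NOT a mass gap, NOT Clay, NOT summit progress; spine 0/9 unchanged.  HONEST DEPENDENCY: continuum YM on T⁴ ⇐ BetaPertH ∧
nine spine estimates (0/9 proved); BetaPertH ⇐ (D1) ∧ (D4) ∧ CAP+tail; G-an2-4 gates asym, D1 and NE2/3/4.  ABSOLUTE RULE kept; no `sorry`.
-/

noncomputable section

open scoped BigOperators ComplexConjugate Matrix Matrix.Norms.L2Operator Kronecker ComplexOrder

namespace Summit.QuantumFields.BalabanUV.T4Continuum.GaugeTermLayer

open Literature.MathematicalPhysics.QuantumFieldTheory.Balaban1983to89.B5Prop11Plancherel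
open Literature.MathematicalPhysics.QuantumFieldTheory.Balaban1983to89.B5G183RateUnitTower (lev lev_neZero)
open Literature.MathematicalPhysics.QuantumFieldTheory.Balaban1983to89.B5Action121 (GradOp)
open Summit.QuantumFields.BalabanUV.T4Continuum
open Summit.QuantumFields.BalabanUV.T4Continuum.BalabanAveragedTowerUnit (idx calGlev one_le_lev' cast_lev')
open Summit.QuantumFields.BalabanUV.T4Continuum.BackgroundResolventTower
open Summit.QuantumFields.BalabanUV.T4Continuum.KingPairingPlantedLaw
open Summit.QuantumFields.BalabanUV.T4Continuum.KroneckerLift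
open Summit.QuantumFields.BalabanUV.T4Continuum.NE2ColourPerturbedLayer (inv_calDalev_kron opNorm_inv_calDalev_kron_le)
open Summit.QuantumFields.BalabanUV.T4Continuum.GaugeTermDecomposition (covGrad defect covGrad_eq sand)
open Summit.QuantumFields.BalabanUV.T4Continuum.GaugeTermSandwichBound (scalOp scalOp_isHermitian Zop Nop projP sand_projP_eq
  opNorm_gradH_mul_calG_le)
open Summit.QuantumFields.BalabanUV.T4Continuum.GaugeTermSandwichLaw
open Summit.QuantumFields.BalabanUV.T4Continuum.GaugeTermResolventBounds
open Summit.QuantumFields.BalabanUV.T4Continuum.GaugeTermTwoLevelNumbers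

variable {d : ℕ} (L : ℕ) [NeZero L] (M : Fin d → ℕ) [hM : ∀ μ, NeZero (M μ)] (a : ℝ) (ha : 0 < a)
variable {o : Type*} [Fintype o] [DecidableEq o] {γ : Type*} [Fintype γ] [DecidableEq γ]

/-! ## §1 The typed objects of one family along the tower -/

/-- the lattice factor `c_k = n_k = L^k` as a complex number. [folklore] -/
abbrev cl (k : ℕ) : ℂ := ((lev L k : ℕ) : ℂ)

variable (R : (k : ℕ) → Fin d → (Tor (fine (lev L k) M) → Matrix o o ℂ)) (Q : (k : ℕ) → Matrix γ (Tor (fine (lev L k) M) × o) ℂ)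
  (a' : ℝ) (J₀ : (k : ℕ) → Matrix (Tor (fine (lev L (k + 1)) M) × o) (Tor (fine (lev L k) M) × o) ℂ)

/-- `S_k = D_kᴴD_k + a′·Q_kᴴQ_k` — the (3.24)-shaped scalar operator of the family at level `k`. [folklore] -/
def Sop (k : ℕ) : Matrix (Tor (fine (lev L k) M) × o) (Tor (fine (lev L k) M) × o) ℂ :=
  scalOp (fine (lev L k) M) (cl L k) (R k) a' (Q k)

/-- `G′_k = S_k⁻¹`. [folklore] -/
def Gop (k : ℕ) : Matrix (Tor (fine (lev L k) M) × o) (Tor (fine (lev L k) M) × o) ℂ := (Sop L M R Q a' k)⁻¹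

/-- `Z_k = Q_k·G′_k·D_kᴴ` — the outer factor (unit layer ← level-`k` colour 1-forms). [folklore] -/
def Zt (k : ℕ) : Matrix γ (idx L M k × o) ℂ := Zop (fine (lev L k) M) (cl L k) (R k) (Gop L M R Q a' k) (Q k)

/-- `N_k = (Q_kG′_kG′_kQ_kᴴ)⁻¹` — the unit-layer factor. [folklore] -/
def Nt (k : ℕ) : Matrix γ γ ℂ := Nop (fine (lev L k) M) (Gop L M R Q a' k) (Q k)

/-- `gaugeP k = D_k·P_k·D_kᴴ`, `P_k = G′_kQ_kᴴN_kQ_kG′_k` — the gauge summand of ONE family at level `k` ((3.25)/(3.26) shape). [folklore] -/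
def gaugeP (k : ℕ) : Matrix (idx L M k × o) (idx L M k × o) ℂ :=
  sand (fine (lev L k) M) (cl L k) (R k) (projP (fine (lev L k) M) (Gop L M R Q a' k) (Q k))

omit [DecidableEq γ] in
/-- `S_k` is Hermitian. [folklore] -/
theorem Sop_isHermitian (k : ℕ) : (Sop L M R Q a' k).IsHermitian := scalOp_isHermitian _ _ _ _ _

omit [DecidableEq γ] in
/-- `G′_k` is Hermitian. [folklore] -/
theorem Gop_conjTranspose (k : ℕ) : (Gop L M R Q a' k)ᴴ = Gop L M R Q a' k := by
  rw [Gop, Matrix.conjTranspose_nonsing_inv, (Sop_isHermitian L M R Q a' k).eq]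

/-- **`gaugeP k = Z_kᴴN_kZ_k`** — the family's gauge summand IS a sandwich (leaf-10's `sand_projP_eq`). [folklore] -/
theorem gaugeP_eq_sandwich (k : ℕ) : gaugeP L M R Q a' k = sandwich (Zt L M R Q a') (Nt L M R Q a') k := by
  rw [gaugeP, sandwich, Zt, Nt]
  exact sand_projP_eq _ _ _ (Gop_conjTranspose L M R Q a' k) _

omit [DecidableEq γ] in
/-- the mass term as a Gram matrix: `a′·QᴴQ = (√a′Q)ᴴ(√a′Q)` for `a′ ≥ 0`. [folklore] -/
theorem smul_gram_eq {σ : Type*} (ha' : 0 ≤ a') (Q₁ : Matrix γ σ ℂ) :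
    ((a' : ℝ) : ℂ) • (Q₁ᴴ * Q₁) = ((((Real.sqrt a' : ℝ) : ℂ)) • Q₁)ᴴ * ((((Real.sqrt a' : ℝ) : ℂ)) • Q₁) := by
  rw [Matrix.conjTranspose_smul, Matrix.smul_mul, Matrix.mul_smul, smul_smul, Complex.star_def, Complex.conj_ofReal,
    ← Complex.ofReal_mul, Real.mul_self_sqrt ha']

omit [DecidableEq γ] in
/-- the mass term is positive semidefinite for `a′ ≥ 0`. [folklore] -/
theorem massTerm_posSemidef {σ : Type*} [Fintype σ] (ha' : 0 ≤ a') (Q₁ : Matrix γ σ ℂ) :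
    (((a' : ℝ) : ℂ) • (Q₁ᴴ * Q₁)).PosSemidef := by
  rw [smul_gram_eq a' ha']; exact Matrix.posSemidef_conjTranspose_mul_self _

omit [DecidableEq γ] in
/-- `S_k = D_kᴴD_k + Y_k` with `Y_k = a′·Q_kᴴQ_k` (definitional) — the Gram-plus-positive shape of `GaugeTermResolventBounds`. [folklore] -/
theorem Sop_eq (k : ℕ) : Sop L M R Q a' k
    = (covGrad (fine (lev L k) M) (cl L k) (R k))ᴴ * covGrad (fine (lev L k) M) (cl L k) (R k) + ((a' : ℝ) : ℂ) • ((Q k)ᴴ * Q k) := rfl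

omit [DecidableEq γ] in
/-- `K_k = Q_kG′_kG′_kQ_kᴴ = (Q_kG′_k)(Q_kG′_k)ᴴ`, so `N_k = K_k⁻¹` is the inverse of a Gram matrix. [folklore] -/
theorem gramK_eq (k : ℕ) : Q k * Gop L M R Q a' k * Gop L M R Q a' k * (Q k)ᴴ = (Q k * Gop L M R Q a' k) * (Q k * Gop L M R Q a' k)ᴴ := by
  rw [Matrix.conjTranspose_mul, Gop_conjTranspose]
  simp only [Matrix.mul_assoc]

/-- `N_k = ((Q_kG′_k)(Q_kG′_k)ᴴ)⁻¹`. [folklore] -/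
theorem Nt_eq (k : ℕ) : Nt L M R Q a' k = ((Q k * Gop L M R Q a' k) * (Q k * Gop L M R Q a' k)ᴴ)⁻¹ := by
  rw [Nt, Nop, gramK_eq]

/-! ## §2 The free vector tower through the lens of this file -/

/-- `(Δ_a^{(k)} ⊗ 1)⁻¹ = 𝒢^{(k)} ⊗ 1` with b05's `calG` displayed (leaf-08's `inv_calDalev_kron`, unfolded). [folklore] -/
theorem inv_kron_eq (k : ℕ) :
    (calDalev L M a ha k ⊗ₖ (1 : Matrix o o ℂ))⁻¹ = calG (lev L k) (one_le_lev' L k) M a ha ⊗ₖ (1 : Matrix o o ℂ) :=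
  inv_calDalev_kron L M a ha k

/-- the free vector propagators are Hermitian, lifted. [folklore] -/
theorem inv_kron_conjTranspose (k : ℕ) :
    ((calDalev L M a ha k ⊗ₖ (1 : Matrix o o ℂ))⁻¹)ᴴ = (calDalev L M a ha k ⊗ₖ (1 : Matrix o o ℂ))⁻¹ := by
  rw [inv_kron_eq, kron_conjTranspose, (calG_isHermitian (lev L k) (one_le_lev' L k) M a ha).eq]

/-- **`‖D_kᴴ·(𝒢^{(k)} ⊗ 1)‖ ≤ (d + α)·Cst`** for the covariant divergence: `D_k = ∂ ⊗ 1 + E_k`, (1.89) in leaf-10's form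
`‖∂ᴴ𝒢‖ ≤ d·Cst`, and `‖E_k‖ ≤ α`. [cite: Balaban1984PropagatorsI, Prop. 1.1 (1.89) p.33] [folklore] -/
theorem opNorm_covGradH_mul_inv_le (k : ℕ) {α : ℝ} (hE : ‖defect (fine (lev L k) M) (cl L k) (R k)‖ ≤ α) :
    ‖(covGrad (fine (lev L k) M) (cl L k) (R k))ᴴ * (calDalev L M a ha k ⊗ₖ (1 : Matrix o o ℂ))⁻¹‖ ≤ (d + α) * Cst d a := by
  have hC := Cst_nonneg d a
  rw [covGrad_eq, Matrix.conjTranspose_add, Matrix.add_mul]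
  have h1 : ‖(GradOp (fine (lev L k) M) (cl L k) ⊗ₖ (1 : Matrix o o ℂ))ᴴ * (calDalev L M a ha k ⊗ₖ (1 : Matrix o o ℂ))⁻¹‖ ≤ d * Cst d a := by
    rw [inv_kron_eq, kron_conjTranspose, ← kron_mul]
    exact opNorm_kron_le_of_le o (opNorm_gradH_mul_calG_le (lev L k) (one_le_lev' L k) M a ha)
  have h2 : ‖(defect (fine (lev L k) M) (cl L k) (R k))ᴴ * (calDalev L M a ha k ⊗ₖ (1 : Matrix o o ℂ))⁻¹‖ ≤ α * Cst d a := by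
    refine (Matrix.l2_opNorm_mul _ _).trans (mul_le_mul ?_ (opNorm_inv_calDalev_kron_le L M a ha k) (norm_nonneg _) ((norm_nonneg _).trans hE))
    rw [Matrix.l2_opNorm_conjTranspose]; exact hE
  calc _ ≤ _ := norm_add_le _ _
    _ ≤ d * Cst d a + α * Cst d a := add_le_add h1 h2
    _ = (d + α) * Cst d a := by ring

/-! ## §3 The bundle of numbers and `SandwichLaws` for the family -/

/-- **THE LAYER'S NUMBERS** (a hypothesis shape on DATA, asserted by nobody; NOT IN PRINT): mass `a′ ≥ 0`; every `S_k` invertible with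
`‖G′_k‖ ≤ g`; `‖Q_k‖ ≤ q`; the defect `‖D_k − ∂ ⊗ 1‖ ≤ α` (row B5); the scalar injected and complement numbers of the family's resolvents
against the 0-form plantings `J₀` — `‖G′_{k+1}J₀ − J₀G′_k‖ ≤ es k`, `‖G′_{k+1}(1 − J₀J₀ᴴ)‖ ≤ ec k` (rows B4.d ∧ B4.e); the sandwiched
covariant-divergence planting number `‖G′_{k+1}(D_{k+1}ᴴJ_k − J₀D_kᴴ)𝒢_k‖ ≤ θ k` (row B4.f); the averaging/planting pairing
`‖Q_{k+1}J₀ − Q_k‖ ≤ q₁ k` (row B3.a). [folklore] -/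
structure LayerLaws (g q α : ℝ) (es ec θ q₁ : ℕ → ℝ) : Prop where
  /-- `a′, q, α ≥ 0` -/
  nonneg : 0 ≤ a' ∧ 0 ≤ q ∧ 0 ≤ α
  /-- every `S_k` is invertible -/
  isUnit_S : ∀ k, IsUnit (Sop L M R Q a' k).det
  /-- `‖G′_k‖ ≤ g` -/
  opNorm_G_le : ∀ k, ‖Gop L M R Q a' k‖ ≤ g
  /-- `‖Q_k‖ ≤ q` -/
  opNorm_Q_le : ∀ k, ‖Q k‖ ≤ q
  /-- `‖D_k − ∂ ⊗ 1‖ ≤ α` -/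
  opNorm_defect_le : ∀ k, ‖defect (fine (lev L k) M) (cl L k) (R k)‖ ≤ α
  /-- scalar injected number -/
  injected_le : ∀ k, ‖Gop L M R Q a' (k + 1) * J₀ k - J₀ k * Gop L M R Q a' k‖ ≤ es k
  /-- scalar complement number -/
  complement_le : ∀ k, ‖Gop L M R Q a' (k + 1) * (1 - J₀ k * (J₀ k)ᴴ)‖ ≤ ec k
  /-- sandwiched covariant-divergence planting number -/
  planting_le : ∀ k, ‖Gop L M R Q a' (k + 1) * ((covGrad (fine (lev L (k + 1)) M) (cl L (k + 1)) (R (k + 1)))ᴴ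
      * (JpcT L M k ⊗ₖ (1 : Matrix o o ℂ)) - J₀ k * (covGrad (fine (lev L k) M) (cl L k) (R k))ᴴ)
      * (calDalev L M a ha k ⊗ₖ (1 : Matrix o o ℂ))⁻¹‖ ≤ θ k
  /-- averaging/planting pairing -/
  pairing_le : ∀ k, ‖Q (k + 1) * J₀ k - Q k‖ ≤ q₁ k

/-- the outer two-level constant `ζ k = q·θ k + q·es k·(d + α)·Cst + q₁ k·√g·Cst`. [folklore] -/
def zetaL (d : ℕ) (a g q α : ℝ) (es θ q₁ : ℕ → ℝ) (k : ℕ) : ℝ :=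
  q * θ k + q * es k * ((d + α) * Cst d a) + q₁ k * Real.sqrt g * Cst d a

/-- the outer error `ε k = q·es k + q₁ k·g` of `Y = QG′` against the plantings. [folklore] -/
def epsL (g q : ℝ) (es q₁ : ℕ → ℝ) (k : ℕ) : ℝ := q * es k + q₁ k * g

/-- the unit-layer two-level constant `ν k = nK·(2qg·ε k + (ε k)² + q·ec k·qg)·nK`. [folklore] -/
def nuL (g q nK : ℝ) (es ec q₁ : ℕ → ℝ) (k : ℕ) : ℝ :=
  nK * (2 * (q * g) * epsL g q es q₁ k + epsL g q es q₁ k * epsL g q es q₁ k + q * ec k * (q * g)) * nK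

variable {L M a ha R Q a' J₀}

omit [DecidableEq γ] in
/-- `‖G′_kD_kᴴ‖ ≤ √g` by positivity. [folklore] -/
theorem opNorm_G_mul_covGradH_le {g q α : ℝ} {es ec θ q₁ : ℕ → ℝ} (h : LayerLaws L M a ha R Q a' J₀ g q α es ec θ q₁) (k : ℕ) :
    ‖Gop L M R Q a' k * (covGrad (fine (lev L k) M) (cl L k) (R k))ᴴ‖ ≤ Real.sqrt g :=
  (opNorm_inv_mul_conjTranspose_le_sqrt (Sop_eq L M R Q a' k) (massTerm_posSemidef a' h.nonneg.1 (Q k)) (h.isUnit_S k)).trans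
    (Real.sqrt_le_sqrt (h.opNorm_G_le k))

omit [DecidableEq γ] in
/-- `‖Z_k‖ ≤ q·√g`. [folklore] -/
theorem opNorm_Zt_le {g q α : ℝ} {es ec θ q₁ : ℕ → ℝ} (h : LayerLaws L M a ha R Q a' J₀ g q α es ec θ q₁) (k : ℕ) :
    ‖Zt L M R Q a' k‖ ≤ q * Real.sqrt g := by
  rw [Zt, Zop, Matrix.mul_assoc]
  exact (Matrix.l2_opNorm_mul _ _).trans (mul_le_mul (h.opNorm_Q_le k) (opNorm_G_mul_covGradH_le h k) (norm_nonneg _) h.nonneg.2.1)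

omit [DecidableEq γ] in
/-- `‖Q_kG′_k‖ ≤ q·g`. [folklore] -/
theorem opNorm_Y_le {g q α : ℝ} {es ec θ q₁ : ℕ → ℝ} (h : LayerLaws L M a ha R Q a' J₀ g q α es ec θ q₁) (k : ℕ) :
    ‖Q k * Gop L M R Q a' k‖ ≤ q * g :=
  (Matrix.l2_opNorm_mul _ _).trans (mul_le_mul (h.opNorm_Q_le k) (h.opNorm_G_le k) (norm_nonneg _) h.nonneg.2.1)

omit [DecidableEq γ] in
/-- **THE OUTER FACTOR'S SANDWICHED CONSISTENCY** `‖(Z_{k+1}(J_k ⊗ 1) − Z_k)(𝒢_k ⊗ 1)‖ ≤ ζ k`. [folklore] -/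
theorem consistent_Zt_le {g q α : ℝ} {es ec θ q₁ : ℕ → ℝ} (h : LayerLaws L M a ha R Q a' J₀ g q α es ec θ q₁) (k : ℕ) :
    ‖(Zt L M R Q a' (k + 1) * (JpcT L M k ⊗ₖ (1 : Matrix o o ℂ)) - Zt L M R Q a' k) * (calDalev L M a ha k ⊗ₖ (1 : Matrix o o ℂ))⁻¹‖
      ≤ zetaL d a g q α es θ q₁ k := by
  rw [Zt, Zt, Zop, Zop]
  exact opNorm_Z_twoLevel_le (h.opNorm_Q_le (k + 1)) (h.planting_le k) (h.injected_le k)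
    (opNorm_covGradH_mul_inv_le L M a ha R k (h.opNorm_defect_le k)) (opNorm_G_mul_covGradH_le h k) (opNorm_inv_calDalev_kron_le L M a ha k)
    (h.pairing_le k)

/-- **THE UNIT-LAYER GRAM'S CONSISTENCY** `‖K_{k+1} − K_k‖ ≤ 2qg·ε k + (ε k)² + q·ec k·qg`. [folklore] -/
theorem gramK_succ_sub_le {g q α : ℝ} {es ec θ q₁ : ℕ → ℝ} (h : LayerLaws L M a ha R Q a' J₀ g q α es ec θ q₁) (k : ℕ) :
    ‖(Q (k + 1) * Gop L M R Q a' (k + 1)) * (Q (k + 1) * Gop L M R Q a' (k + 1))ᴴ - (Q k * Gop L M R Q a' k) * (Q k * Gop L M R Q a' k)ᴴ‖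
      ≤ 2 * (q * g) * epsL g q es q₁ k + epsL g q es q₁ k * epsL g q es q₁ k + q * ec k * (q * g) :=
  opNorm_gramK_twoLevel_le (h.opNorm_Q_le (k + 1))
    (outer_E_le (h.opNorm_Q_le (k + 1)) (h.injected_le k) (h.pairing_le k) (h.opNorm_G_le k)) (h.complement_le k)
    (opNorm_Y_le h k) (opNorm_Y_le h (k + 1))

/-- **THE UNIT-LAYER FACTOR'S CONSISTENCY** `‖N_{k+1} − N_k‖ ≤ ν k`, given invertibility of every `K_k` and `‖N_k‖ ≤ nK`. [folklore] -/
theorem consistent_Nt_le {g q α nK : ℝ} {es ec θ q₁ : ℕ → ℝ} (h : LayerLaws L M a ha R Q a' J₀ g q α es ec θ q₁)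
    (hK : ∀ k, IsUnit (Q k * Gop L M R Q a' k * Gop L M R Q a' k * (Q k)ᴴ).det) (hN : ∀ k, ‖Nt L M R Q a' k‖ ≤ nK) (k : ℕ) :
    ‖Nt L M R Q a' (k + 1) - Nt L M R Q a' k‖ ≤ nuL g q nK es ec q₁ k := by
  have hK' : ∀ j, IsUnit ((Q j * Gop L M R Q a' j) * (Q j * Gop L M R Q a' j)ᴴ).det := fun j => by rw [← gramK_eq]; exact hK j
  have hN' : ∀ j, ‖((Q j * Gop L M R Q a' j) * (Q j * Gop L M R Q a' j)ᴴ)⁻¹‖ ≤ nK := fun j => by rw [← Nt_eq]; exact hN j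
  have hnK : 0 ≤ nK := (norm_nonneg _).trans (hN 0)
  rw [Nt_eq, Nt_eq]
  refine (opNorm_inv_sub_inv_le_of_isUnit (hK' (k + 1)) (hK' k)).trans ?_
  unfold nuL
  exact mul_le_mul (mul_le_mul (hN' (k + 1)) (gramK_succ_sub_le h k) (norm_nonneg _) hnK) (hN' k) (norm_nonneg _)
    (mul_nonneg hnK ((norm_nonneg _).trans (gramK_succ_sub_le h k)))

/-- **`SandwichLaws` FOR THE FAMILY** from its `LayerLaws`, invertibility of the unit-layer Grams and `‖N_k‖ ≤ nK`. [folklore] -/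
theorem sandwichLaws_of_layerLaws {g q α nK : ℝ} {es ec θ q₁ : ℕ → ℝ} (h : LayerLaws L M a ha R Q a' J₀ g q α es ec θ q₁)
    (hK : ∀ k, IsUnit (Q k * Gop L M R Q a' k * Gop L M R Q a' k * (Q k)ᴴ).det) (hN : ∀ k, ‖Nt L M R Q a' k‖ ≤ nK) :
    SandwichLaws (fun k => calDalev L M a ha k ⊗ₖ (1 : Matrix o o ℂ)) (fun k => JpcT L M k ⊗ₖ (1 : Matrix o o ℂ))
      (Zt L M R Q a') (Nt L M R Q a') (q * Real.sqrt g) nK (zetaL d a g q α es θ q₁) (nuL g q nK es ec q₁) where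
  nonneg := ⟨mul_nonneg h.nonneg.2.1 (Real.sqrt_nonneg g), (norm_nonneg _).trans (hN 0)⟩
  opNorm_Z_le := opNorm_Zt_le h
  opNorm_N_le := hN
  consistent_Z_le := consistent_Zt_le h
  consistent_N_le := consistent_Nt_le h hK hN

end Summit.QuantumFields.BalabanUV.T4Continuum.GaugeTermLayer

end
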